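import Literature.NumberTheory.EllipticCurves.TateCurve.UniformizationPoints
import Mathlib.Analysis.Normed.Unbundled.SpectralNorm
import HarnessLib

/-!
# The Tate curve has no non-zero infinitely divisible rational point (over a discretely valued field
# whose units have none; in particular over a `p`-adic field)

Topic `Literature/NumberTheory/EllipticCurves/TateCurve`, namespace
`Literature.NumberTheory.EllipticCurves.TateCurve` (abc-iut cell, TRANCHE-T1 P21 = the Tate-curve API, seat
abc-iut-L2-t5). Silverman, *Advanced Topics in the Arithmetic of Elliptic Curves*, GTM 151, Thm. V.3.1 (c)(d)
(PDF p. 395): "`φ : K^*/q^ℤ ⥲ E_q(K)`" — the tree's THEOREM `tateUniformizationMulEquiv` (`UniformizationPoints.lean`).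
Mochizuki, *Topics in Absolute Anabelian Geometry III*, Def. 1.5 (a) p. 32 asks of an abelian variety `A/k`:
"`⋂_{N ≥ 1} N · A(k) = {0}`", and Rmk. 1.5.4 (i) p. 33 asserts it for finite extensions `k` of `ℚ_p` ("`A(k)` is
an extension of a finitely generated `ℤ`-module by a compact abelian `p`-adic Lie group [...] In particular, the
condition of Definition 1.5, (a), is satisfied"). This file PROVES that clause for the Mordell–Weil group of the
TATE CURVE `E_q`, by an elementary route through the uniformisation (no `p`-adic Lie groups):

* `QuotientGroup.eq_one_of_forall_exists_pow_eq` — if `U, N ≤ G` meet trivially, `U` has no non-trivial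
  divisible element, and some fixed power `x ↦ x^e` (`e ≥ 1`) lands in `U·N`, then `G/N` has no non-trivial
  divisible element (a divisible class is the class of some `u ∈ U`, which is then divisible inside `U`);
* `unitsModZPowers_eq_one_of_divisible` — for a normed field `K` whose unit group `Kˣ` has no non-trivial
  divisible element and whose value group is discrete relative to `q` (`∃ e ≥ 1, ∀ x, ‖x‖^e ∈ ‖q‖^ℤ`),
  `Kˣ/q^ℤ` has none either (`U` := the norm-one units, `N := q^ℤ`);
* **`point_eq_zero_of_divisible`** — under the same two hypotheses, a point `P ∈ E_q(K)` with `P ∈ n·E_q(K)`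
  for every `n ≥ 1` is `0` (transport along `tateUniformizationMulEquiv`);
* `exists_norm_pow_eq_norm_zpow` — the discreteness hypothesis for ANY normed field structure on a finite
  extension `K` of `ℚ_p` making it a normed `ℚ_p`-algebra (the norm is the spectral norm, Mathlib's
  `NormedAlgebra.norm_eq_spectralNorm`; `‖z‖^{[K:ℚ_p]!} ∈ p^ℤ` from `‖z‖ = ‖a₀‖_p^{1/deg}`, `a₀` the constant
  coefficient of the minimal polynomial — the route of the tree's `KummerFaithfulPadicProofs`).

The remaining hypothesis "`Kˣ` has no non-trivial divisible element" is, for `K/ℚ_p` finite, the tree's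
`Literature.AnabelianGeometry.AbsoluteAnabelian.AbsTopIII.divisibleElementsTrivial_units_of_finite_padic`;
the assembled `p`-adic statement (Def. 1.5 (a) for `E_q(K)`) is the companion file
`AbsTopIII/KummerFaithfulTateCurveProofs.lean`, kept there so that this Tate-curve file imports no scheme theory.
HONEST FRAMING: OUR kernel proof of a classical fact; nothing here bears on [IUTchIII] Cor. 3.12.

## References
* [SilvermanATAEC1994] J. H. Silverman, *Advanced Topics in the Arithmetic of Elliptic Curves*, GTM 151,
  Springer 1994, Thm. V.3.1 (c)(d) (PDF p. 395).
* [MochizukiAbsTopIII2015] S. Mochizuki, *Topics in Absolute Anabelian Geometry III*, J. Math. Sci. Univ.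
  Tokyo 22 (2015), Def. 1.5 (a) p. 32, Rmk. 1.5.4 (i) p. 33 (manuscript pagination).
-/

noncomputable section

open scoped Classical

namespace Literature.NumberTheory.EllipticCurves.TateCurve

open SteinWuthrich2013 WeierstrassCurve

universe u

/-! ### Quotients inherit "no divisible elements" from a complement of finite exponent -/

/-- **Divisible elements of a quotient.** Let `G` be a commutative group, `N, U ≤ G` with `U ∩ N = 1`, suppose
`U` has no non-trivial element admitting `n`-th roots in `U` for every `n ≥ 1`, and that for some `e ≥ 1` every
`x^e` lies in `U·N`. Then an element of `G/N` admitting `n`-th roots for every `n ≥ 1` is trivial. (The shape of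
"`A(k)` is an extension of a finitely generated `ℤ`-module by a compact [...] group", Rmk. 1.5.4 (i), made
elementary for `K^×/q^ℤ`: `U = O_K^×`, `N = q^ℤ`, `e = ord(q)`.) [cite: MochizukiAbsTopIII2015, Rmk 1.5.4 (i) p.33] -/
theorem QuotientGroup.eq_one_of_forall_exists_pow_eq {G : Type*} [CommGroup G] (N U : Subgroup G)
    (hUN : ∀ u ∈ U, u ∈ N → u = 1) (hU : ∀ u ∈ U, (∀ n : ℕ, 0 < n → ∃ v ∈ U, v ^ n = u) → u = 1)
    {e : ℕ} (he : 0 < e) (hpow : ∀ x : G, ∃ u ∈ U, x ^ e / u ∈ N) (x : G ⧸ N)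
    (hx : ∀ n : ℕ, 0 < n → ∃ y : G ⧸ N, y ^ n = x) : x = 1 := by
  obtain ⟨g, rfl⟩ := QuotientGroup.mk_surjective x
  -- the class of `g` is the class of some `u ∈ U`
  obtain ⟨y, hy⟩ := hx e he
  obtain ⟨y, rfl⟩ := QuotientGroup.mk_surjective y
  obtain ⟨u, huU, hu⟩ := hpow y
  have hyu : ((y ^ e : G) : G ⧸ N) = (u : G ⧸ N) := QuotientGroup.eq_iff_div_mem.mpr hu
  have hgu : ((g : G) : G ⧸ N) = (u : G ⧸ N) := by rw [← hyu, QuotientGroup.mk_pow, hy]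
  -- `u` is divisible inside `U`
  have hu1 : u = 1 := hU u huU fun n hn => by
    obtain ⟨z, hz⟩ := hx (e * n) (Nat.mul_pos he hn)
    obtain ⟨z, rfl⟩ := QuotientGroup.mk_surjective z
    obtain ⟨u', hu'U, hu'⟩ := hpow z
    have hzu' : ((z ^ e : G) : G ⧸ N) = (u' : G ⧸ N) := QuotientGroup.eq_iff_div_mem.mpr hu'
    have h1 : ((u' ^ n : G) : G ⧸ N) = (u : G ⧸ N) := by
      rw [QuotientGroup.mk_pow, ← hzu', ← QuotientGroup.mk_pow, ← pow_mul, QuotientGroup.mk_pow, hz, hgu]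
    refine ⟨u', hu'U, ?_⟩
    have hmem : u' ^ n / u ∈ N := QuotientGroup.eq_iff_div_mem.mp h1
    exact div_eq_one.mp (hUN _ (U.div_mem (U.pow_mem hu'U n) huU) hmem)
  rw [hgu, hu1, QuotientGroup.mk_one]

/-! ### `K^×/q^ℤ` -/

section UnitsModQ

variable {K : Type u} [NontriviallyNormedField K] {q : K}

/-- **`K^×/q^ℤ` has no non-trivial divisible element** when `Kˣ` has none and the value group is discrete
relative to `q` (`0 < ‖q‖ < 1`): with `U` the norm-one units (`U ∩ q^ℤ = 1` as `‖q‖ ≠ 1`) and `x^e·q^{-f}`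
of norm one. [cite: SilvermanATAEC1994, Thm. V.3.1 (c)(d) (PDF p. 395)] -/
theorem unitsModZPowers_eq_one_of_divisible (hq0 : q ≠ 0) (hq : ‖q‖ < 1)
    (hK : ∀ x : Kˣ, (∀ n : ℕ, 0 < n → ∃ y : Kˣ, y ^ n = x) → x = 1)
    (hdisc : ∃ e : ℕ, 0 < e ∧ ∀ x : Kˣ, ∃ f : ℤ, ‖(x : K)‖ ^ e = ‖q‖ ^ f)
    (x : Kˣ ⧸ Subgroup.zpowers (Units.mk0 q hq0))
    (hx : ∀ n : ℕ, 0 < n → ∃ y : Kˣ ⧸ Subgroup.zpowers (Units.mk0 q hq0), y ^ n = x) : x = 1 := by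
  have hqpos : 0 < ‖q‖ := norm_pos_iff.mpr hq0
  -- `U` := the norm-one units
  let nrm : Kˣ →* ℝ := (normHom : K →*₀ ℝ).toMonoidHom.comp (Units.coeHom K)
  have hnrm : ∀ u : Kˣ, nrm u = ‖(u : K)‖ := fun _ => rfl
  let U : Subgroup Kˣ := nrm.ker
  have hmemU : ∀ u : Kˣ, u ∈ U ↔ ‖(u : K)‖ = 1 := fun u => by rw [MonoidHom.mem_ker, hnrm]
  obtain ⟨e, he, hef⟩ := hdisc
  refine QuotientGroup.eq_one_of_forall_exists_pow_eq _ U ?_ ?_ he ?_ x hx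
  · -- `U ∩ q^ℤ = 1`
    intro u huU huN
    obtain ⟨n, rfl⟩ := Subgroup.mem_zpowers_iff.mp huN
    have h1 : ‖q‖ ^ n = 1 := by
      rw [← norm_zpow, ← Units.val_mk0 hq0, ← Units.val_zpow_eq_zpow_val]
      exact (hmemU _).mp huU
    rw [(zpow_eq_one_iff_right₀ hqpos.le hq.ne).mp h1, zpow_zero]
  · -- no divisible norm-one unit
    intro u _ hu
    exact hK u fun n hn => by
      obtain ⟨v, -, hv⟩ := hu n hn
      exact ⟨v, hv⟩
  · -- `x^e · q^{-f}` has norm one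
    intro x
    obtain ⟨f, hf⟩ := hef x
    refine ⟨(Units.mk0 q hq0 ^ f)⁻¹ * x ^ e, (hmemU _).mpr ?_, ?_⟩
    · rw [Units.val_mul, norm_mul, Units.val_inv_eq_inv_val, norm_inv, Units.val_zpow_eq_zpow_val,
        Units.val_mk0, norm_zpow, Units.val_pow_eq_pow_val, norm_pow, hf,
        inv_mul_cancel₀ (zpow_ne_zero f hqpos.ne')]
    · rw [div_eq_mul_inv, mul_inv_rev, inv_inv, mul_inv_cancel_left]
      exact Subgroup.zpow_mem _ (Subgroup.mem_zpowers _) f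

/-! ### The Tate curve -/

variable [CompleteSpace K] [IsUltrametricDist K] [CharZero K]

/-- **No non-zero infinitely divisible point on the Tate curve.** For a complete ultrametric field `K` of
characteristic `0` whose unit group has no non-trivial divisible element and whose value group is discrete
relative to `q` (`0 < ‖q‖ < 1`), a point `P ∈ E_q(K)` lying in `n·E_q(K)` for every `n ≥ 1` is `0` — transport
of `unitsModZPowers_eq_one_of_divisible` along Tate's uniformisation `K^×/q^ℤ ≅ E_q(K)`
(`tateUniformizationMulEquiv`). [cite: SilvermanATAEC1994, Thm. V.3.1 (c)(d) (PDF p. 395)] -/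
theorem point_eq_zero_of_divisible (hq0 : q ≠ 0) (hq : ‖q‖ < 1)
    (hK : ∀ x : Kˣ, (∀ n : ℕ, 0 < n → ∃ y : Kˣ, y ^ n = x) → x = 1)
    (hdisc : ∃ e : ℕ, 0 < e ∧ ∀ x : Kˣ, ∃ f : ℤ, ‖(x : K)‖ ^ e = ‖q‖ ^ f)
    (P : (tateCurve q).toAffine.Point)
    (hP : ∀ n : ℕ, 0 < n → ∃ Q : (tateCurve q).toAffine.Point, n • Q = P) : P = 0 := by
  set φ := tateUniformizationMulEquiv hq0 hq with hφ
  have hx : φ.symm (Multiplicative.ofAdd P) = 1 := by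
    refine unitsModZPowers_eq_one_of_divisible hq0 hq hK hdisc _ fun n hn => ?_
    obtain ⟨Q, hQ⟩ := hP n hn
    exact ⟨φ.symm (Multiplicative.ofAdd Q), by rw [← map_pow, ← ofAdd_nsmul, hQ]⟩
  have h := congrArg φ hx
  rw [MulEquiv.apply_symm_apply, map_one] at h
  exact Multiplicative.ofAdd.injective h

end UnitsModQ

/-! ### Discreteness of the value group of a `p`-adic field (any compatible norm) -/

section Padic

variable (p : ℕ) [Fact p.Prime] {K : Type u} [NontriviallyNormedField K] [NormedAlgebra ℚ_[p] K]
  [FiniteDimensional ℚ_[p] K]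

/-- **The value group of a `p`-adic field is discrete**: for a finite extension `K` of `ℚ_p` with any normed-field
structure making it a normed `ℚ_p`-algebra (that norm IS the spectral norm), `‖z‖^{[K:ℚ_p]!} = p^m` for some
`m ∈ ℤ`, for every `z ≠ 0` — from `‖z‖ = ‖a₀‖_p^{1/deg(minpoly)}` with `deg ∣ [K:ℚ_p]!`.
[cite: MochizukiAbsTopIII2015, Rmk 1.5.4 (i) p.33] -/
theorem exists_norm_pow_factorial_eq_zpow (z : K) (hz : z ≠ 0) :
    ∃ m : ℤ, ‖z‖ ^ (Module.finrank ℚ_[p] K).factorial = (p : ℝ) ^ m := by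
  haveI : Algebra.IsAlgebraic ℚ_[p] K := Algebra.IsAlgebraic.of_finite ℚ_[p] K
  have hint : IsIntegral ℚ_[p] z := Algebra.IsIntegral.isIntegral z
  have hdpos : 0 < (minpoly ℚ_[p] z).natDegree := minpoly.natDegree_pos hint
  have hdle : (minpoly ℚ_[p] z).natDegree ≤ Module.finrank ℚ_[p] K := minpoly.natDegree_le z
  obtain ⟨c, hc⟩ := Nat.dvd_factorial hdpos hdle
  have ha0 : (minpoly ℚ_[p] z).coeff 0 ≠ 0 := minpoly.coeff_zero_ne_zero hint hz
  have hnorm : ‖z‖ ^ (minpoly ℚ_[p] z).natDegree = ‖(minpoly ℚ_[p] z).coeff 0‖ := by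
    rw [NormedAlgebra.norm_eq_spectralNorm ℚ_[p] z, spectralNorm.spectralNorm_eq_norm_coeff_zero_rpow ℚ_[p] K z,
      one_div, Real.rpow_inv_natCast_pow (norm_nonneg _) hdpos.ne']
  refine ⟨-((minpoly ℚ_[p] z).coeff 0).valuation * c, ?_⟩
  rw [hc, pow_mul, hnorm, Padic.norm_eq_zpow_neg_valuation ha0, ← zpow_natCast, ← zpow_mul]

include p in
/-- **Discreteness relative to `q`**: for `0 < ‖q‖ < 1` in such a `K` there is `e ≥ 1` with `‖x‖^e ∈ ‖q‖^ℤ` for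
every `x ∈ Kˣ` — the hypothesis `hdisc` of `point_eq_zero_of_divisible`.
[cite: MochizukiAbsTopIII2015, Rmk 1.5.4 (i) p.33] -/
theorem exists_norm_pow_eq_norm_zpow {q : K} (hq0 : q ≠ 0) (hq : ‖q‖ < 1) :
    ∃ e : ℕ, 0 < e ∧ ∀ x : Kˣ, ∃ f : ℤ, ‖(x : K)‖ ^ e = ‖q‖ ^ f := by
  have hdpos : 0 < (Module.finrank ℚ_[p] K).factorial := Nat.factorial_pos _
  have hp1 : (1 : ℝ) < p := by exact_mod_cast (Fact.out : p.Prime).one_lt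
  obtain ⟨mq, hmq⟩ := exists_norm_pow_factorial_eq_zpow p q hq0
  have hmq_neg : mq < 0 := by
    have h1 : ‖q‖ ^ (Module.finrank ℚ_[p] K).factorial < 1 := pow_lt_one₀ (norm_nonneg q) hq hdpos.ne'
    rw [hmq] at h1
    exact (zpow_lt_one_iff_right₀ hp1).mp h1
  have habs : ((mq.natAbs : ℕ) : ℤ) = -mq := by rw [Int.natCast_natAbs, abs_of_neg hmq_neg]
  refine ⟨(Module.finrank ℚ_[p] K).factorial * mq.natAbs, Nat.mul_pos hdpos (Int.natAbs_pos.mpr hmq_neg.ne),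
    fun x => ?_⟩
  obtain ⟨mx, hmx⟩ := exists_norm_pow_factorial_eq_zpow p (x : K) x.ne_zero
  refine ⟨-(((Module.finrank ℚ_[p] K).factorial : ℤ) * mx), ?_⟩
  rw [pow_mul, hmx, ← zpow_natCast ((p : ℝ) ^ mx), ← zpow_mul, habs, zpow_neg, zpow_mul ‖q‖, zpow_natCast, hmq,
    ← zpow_mul, ← zpow_neg, mul_neg, mul_comm mx mq]

end Padic

end Literature.NumberTheory.EllipticCurves.TateCurve

end
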